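import Summits.ABC.ABC.Theses.IneffectiveSubspace
import Summits.ABC.ABC.Theorems.IneffectiveSubspaceDeepRegimeABCCensusFirstMembers
import Summits.ABC.ABC.Theorems.IneffectiveSubspaceDeepRegimeABCCensusCellEightD
import Summits.ABC.ABC.Theorems.IneffectiveSubspaceDeepRegimeABCCensusCellNine18E
import Summits.ABC.ABC.Theorems.IneffectiveSubspaceDeepRegimeABCCensusCellNine19J
import Summits.ABC.ABC.Theorems.IneffectiveSubspaceDeepRegimeABCCensusCellTen20C
import Summits.ABC.ABC.Theorems.IneffectiveSubspaceDeepRegimeABCCensusCellEight17E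
import Summits.ABC.ABC.Theorems.IneffectiveSubspaceDeepRegimeABCCensusStaircase
import Summits.ABC.ABC.Theorems.IneffectiveSubspaceDeepRegimeABCCensusDeepSevenRecord
import Summits.ABC.ABC.Theorems.IneffectiveSubspaceDeepRegimeABCCensusDeepEightRecord

/-!
# `DeepRegimeABC` (stmt-ABC-15121): the certified profile of the deep regime — one statement

Assembly file (line lead `prover-line-stmt-ABC-15121-c3-0`, 2026-08-16; human certificate objective) for the
crux `Summit.ABC.ABC.Theses.IneffectiveSubspace.DeepRegimeABC` (abc with exponent `1 + ε` on the deep tail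
`{ω₅(abc) ≥ K(ε)}`, `ω₅(n) := #{p : p⁵ ∣ n}`).  It imports the census files of the leads c1-0 / c2-0 / c3-0
and states the certified PROFILE of the deep cells `{ω₅ ≥ K}` as a single theorem `censusProfile`, the
citation point for consumers (planners, the disprover, the dossier):

1. **where the cells begin** — the least `c` of an abc triple with `ω₅(abc) ≥ K` is EXACTLY
   `firstMemberOf K = 32, 243, 5312, 571293, 260861447, 38288446875, 8458700490625, 23115230230115023,
   9830010031629917248` for `K = 1, …, 9` (attained; `c₉ = 2⁶·7⁵·17⁵·23⁵ = 5⁵·19⁵·31·661·12539 +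
   3⁵·11⁵·13⁵·539677`, the only member of its cell below `10¹⁹`), and the cell `K = 10` begins beyond `10²⁰`;
2. **how fast they recede** — `ω₅(abc) ≥ K ⟹ c > 10^(2K-1)` for EVERY `K ≥ 8` (enumerations for
   `8 ≤ K ≤ 14`, the primorial floor `4·(p₀⋯p_{K-1})⁵ ≤ c³` beyond), and `c > 10^(2K)` for `K = 8, 9, 10`;
3. **what the first deep cell beyond the records looks like** — the abc triples with `ω₅ ≥ 8` and
   `c ≤ 10¹⁷` are exactly the thirty of `cellEightMembers17`, none of them a hit (`c ≤ rad(abc)`);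
4. **the deep cells keep producing hits** — the cell `ω₅ ≥ 7` holds a triple of quality `> 1.2138`
   (`(7·59)⁵ + 2⁶·3⁵·5⁷·11³·17·79 = 43·(19·29)⁵`) and the cell `ω₅ ≥ 8` one of quality `> 1.0790`
   (`2⁵·7⁶·41⁵·83 + 3⁹·17⁵·887·8573 = 5⁵·11⁸·13⁵`, record below `10¹⁸`; eleven hits below `10¹⁸`, the first
   at `c ≈ 2.4·10¹⁷`), so no constant-free threshold `K ≤ 7` is admissible at `ε ≤ 0.2138` and none `≤ 8`
   at `ε ≤ 0.079` (records of the cells `4, 5, 6` in their certified boxes: `1.345, 1.218, 1.140`,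
   `Negative/Census*.lean` of the compute seat).

Everything is imported; this file adds only the table `firstMemberOf` (a `match`, no new data) and the
bookkeeping.  Reading for the crux: nothing here bears on its truth (it is abc-hard: `¬crux ⟹ ¬ABC`); it is
the requested checkable enumeration witness of the deep regime, kernel-checked modulo the `native_decide`
runs of the imported certificate files.
-/

-- `Summit.<Summit>.<Problem>` is the mandated summit-side namespace (CONVENTIONS §2); for the
-- single-conjunct summit `ABC` the two coincide, so the duplicate `ABC.ABC` is deliberate.
set_option linter.dupNamespace false

namespace Summit.ABC.ABC.Theorems.DeepRegimeABC

open Literature.NumberTheory.DiophantineGeometry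

/-- **The first members of the deep cells**: the least `c` of an abc triple with `ω₅(abc) ≥ K`,
`K = 1, …, 9` (`0` elsewhere). [folklore] -/
def firstMemberOf : ℕ → ℕ
  | 1 => 32
  | 2 => 243
  | 3 => 5312
  | 4 => 571293
  | 5 => 260861447
  | 6 => 38288446875
  | 7 => 8458700490625
  | 8 => 23115230230115023
  | 9 => 9830010031629917248
  | _ => 0

/-- The cells begin at `firstMemberOf`: **every abc triple with `ω₅(abc) ≥ K`, `1 ≤ K ≤ 9`, has
`c ≥ firstMemberOf K`.** [folklore] -/
theorem firstMemberOf_le {a b c K : ℕ} (habc : IsABCTriple a b c) (h1 : 1 ≤ K) (h8 : K ≤ 9)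
    (hK : K ≤ ((a * b * c).primeFactors.filter (fun p => 5 ≤ (a * b * c).factorization p)).card) :
    firstMemberOf K ≤ c := by
  interval_cases K
  · exact le_of_one_le_depth habc hK
  · exact le_of_two_le_depth habc hK
  · exact le_of_three_le_depth habc hK
  · exact le_of_four_le_depth habc hK
  · exact le_of_five_le_depth habc hK
  · exact le_of_six_le_depth habc hK
  · exact le_of_seven_le_depth habc hK
  · exact le_of_eight_le_depth habc hK
  · exact le_of_nine_le_depth habc hK

/-- … and the bound is attained: **for `1 ≤ K ≤ 9` there is an abc triple with `ω₅(abc) ≥ K` and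
`c = firstMemberOf K`.** [folklore] -/
theorem firstMemberOf_attained {K : ℕ} (h1 : 1 ≤ K) (h8 : K ≤ 9) :
    ∃ a b c : ℕ, IsABCTriple a b c ∧
      K ≤ ((a * b * c).primeFactors.filter (fun p => 5 ≤ (a * b * c).factorization p)).card ∧
      c = firstMemberOf K := by
  interval_cases K
  · exact ⟨_, _, _, firstMember_one.1, firstMember_one.2, rfl⟩
  · exact ⟨_, _, _, firstMember_two.1, firstMember_two.2, rfl⟩
  · exact ⟨_, _, _, firstMember_three.1, firstMember_three.2, rfl⟩
  · exact ⟨_, _, _, firstMember_four.1, firstMember_four.2, rfl⟩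
  · exact ⟨_, _, _, firstMember_five.1, firstMember_five.2, rfl⟩
  · exact ⟨_, _, _, firstMember_six.1, firstMember_six.2, rfl⟩
  · exact ⟨_, _, _, firstMember_seven.1, firstMember_seven.2, rfl⟩
  · exact ⟨_, _, _, firstMember_eight.1, firstMember_eight.2, rfl⟩
  · exact ⟨_, _, _, firstMember_nine.1, firstMember_nine.2, rfl⟩

/-! ## Registered certificate stub of the crux item (stmt-ABC-15121) -/

/-- **Registered certificate `censusProfile`** (crux `DeepRegimeABC`, line SketchIdeator5R2, human certificate
objective) — the certified profile of the deep regime in one statement: (1) first members `c_K = firstMemberOf K`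
exactly for `K ≤ 9`, attained; (2) `ω₅ ≤ 8` below `10¹⁸`, `ω₅ ≤ 9` below `10²⁰`; (3) the staircase
`ω₅ ≥ K ⟹ c > 10^(2K-1)` for every `K ≥ 8` and the primorial floor `4·(p₀⋯p_{K-1})⁵ ≤ c³` for every `K`;
(4) the abc triples with `ω₅ ≥ 8`, `c ≤ 10¹⁷` are exactly the thirty of `cellEightMembers17`, none a hit;
(5) the cells `ω₅ ≥ 7` / `ω₅ ≥ 8` hold triples of quality `> 1.2138` / `> 1.0790`, so every constant-free
threshold is `≥ 8` at `ε ≤ 0.2138` and `≥ 9` at `ε ≤ 0.079`. [folklore] -/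
theorem censusProfile : (∀ a b c K : ℕ, Literature.NumberTheory.DiophantineGeometry.IsABCTriple a b c → 1 ≤ K → K ≤ 9 → K ≤ ((a * b * c).primeFactors.filter (fun p => 5 ≤ (a * b * c).factorization p)).card → Summit.ABC.ABC.Theorems.DeepRegimeABC.firstMemberOf K ≤ c) ∧ (∀ K : ℕ, 1 ≤ K → K ≤ 9 → ∃ a b c : ℕ, Literature.NumberTheory.DiophantineGeometry.IsABCTriple a b c ∧ K ≤ ((a * b * c).primeFactors.filter (fun p => 5 ≤ (a * b * c).factorization p)).card ∧ c = Summit.ABC.ABC.Theorems.DeepRegimeABC.firstMemberOf K) ∧ (∀ a b c : ℕ, Literature.NumberTheory.DiophantineGeometry.IsABCTriple a b c → c ≤ 10 ^ 18 → ((a * b * c).primeFactors.filter (fun p => 5 ≤ (a * b * c).factorization p)).card ≤ 8) ∧ (∀ a b c : ℕ, Literature.NumberTheory.DiophantineGeometry.IsABCTriple a b c → c ≤ 10 ^ 20 → ((a * b * c).primeFactors.filter (fun p => 5 ≤ (a * b * c).factorization p)).card ≤ 9) ∧ (∀ a b c K : ℕ, Literature.NumberTheory.DiophantineGeometry.IsABCTriple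 a b c → 8 ≤ K → K ≤ ((a * b * c).primeFactors.filter (fun p => 5 ≤ (a * b * c).factorization p)).card → 10 ^ (2 * K - 1) < c) ∧ (∀ a b c K : ℕ, Literature.NumberTheory.DiophantineGeometry.IsABCTriple a b c → K ≤ ((a * b * c).primeFactors.filter (fun p => 5 ≤ (a * b * c).factorization p)).card → 4 * (∏ i ∈ Finset.range K, Nat.nth Nat.Prime i) ^ 5 ≤ c ^ 3) ∧ (∀ a b c : ℕ, Literature.NumberTheory.DiophantineGeometry.IsABCTriple a b c → c ≤ 10 ^ 17 → 8 ≤ ((a * b * c).primeFactors.filter (fun p => 5 ≤ (a * b * c).factorization p)).card → ((a, b, c) ∈ Summit.ABC.ABC.Theorems.DeepRegimeABC.cellEightMembers17 ∨ (b, a, c) ∈ Summit.ABC.ABC.Theorems.DeepRegimeABC.cellEightMembers17) ∧ c ≤ Literature.NumberTheory.DiophantineGeometry.rad a b c) ∧ (∀ ε : ℝ, ε ≤ 0.2138 → ∀ K : ℕ, (∀ a b c : ℕ, Literature.NumberTheory.DiophantineGeometry.IsABCTriple a b c → K ≤ ((a * b * c).primeFactors.filter (fun p => 5 ≤ (a *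 b * c).factorization p)).card → (c : ℝ) < ((Literature.NumberTheory.DiophantineGeometry.rad a b c : ℕ) : ℝ) ^ (1 + ε)) → 8 ≤ K) ∧ (∀ ε : ℝ, ε ≤ 0.079 → ∀ K : ℕ, (∀ a b c : ℕ, Literature.NumberTheory.DiophantineGeometry.IsABCTriple a b c → K ≤ ((a * b * c).primeFactors.filter (fun p => 5 ≤ (a * b * c).factorization p)).card → (c : ℝ) < ((Literature.NumberTheory.DiophantineGeometry.rad a b c : ℕ) : ℝ) ^ (1 + ε)) → 9 ≤ K) :=
  ⟨fun _ _ _ _ h h1 h8 hK => firstMemberOf_le h h1 h8 hK,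
    fun _ h1 h8 => firstMemberOf_attained h1 h8,
    fun _ _ _ h hc => depth_le_eight_of_le_tenPow18 h hc,
    fun _ _ _ h hc => depth_le_nine_of_le_tenPow20 h hc,
    fun _ _ _ _ h h8 hK => tenPow_lt_of_le_depth_all h h8 hK,
    fun _ _ _ _ h hK => four_mul_primorial_pow_le_cube h hK,
    fun _ _ _ h hc hK => ⟨mem_cellEightMembers17_of_le_tenPow17 h hc hK, rad_ge_of_le_tenPow17 h hc hK⟩,
    fun _ hε _ h => constFree_threshold_ge_eight hε h,
    fun _ hε _ h => constFree_threshold_ge_nine hε h⟩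

end Summit.ABC.ABC.Theorems.DeepRegimeABC
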